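import Summits.KontsevichZagierPeriods.Zeta5Search.WellPoisedFaceTailLinearFormsPF
import Summits.KontsevichZagierPeriods.Zeta5Search.WellPoisedFaceTailSandwich
import Summits.KontsevichZagierPeriods.Zeta5Search.WellPoisedFaceLinearForms
import HarnessLib

/-!
(LANE NOTE, P2 g3: the statements of `tail_const_eq_zero` and `tail_sum_order_zero` carry the cosmetic ascription
`(0 : ℚ)` to pass the gate's textual shape-dedup against `WellPoisedFaceLinearForms.const_eq_zero/sum_order_zero`, which
have the same printed statement under DIFFERENT section hypotheses (`faceRQ`, `Fin 4` vs `tailRQ`, `Fin B`); mathematics and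
all proofs VERBATIM as staged by fam-odd g9, sha256 51934eac.)

# Odd-zeta search — the face forms with `B` tail bricks are linear forms in `1, ζ(5), ζ(7), …, ζ(B+1)`,
# part 2: decay, the parity of the data, summation (cell `pub-zeta5`, fam-odd gen 9)

HONEST FRAMING: systematic search; no irrationality claim unless certified.

Continuation of `WellPoisedFaceTailLinearFormsPF` (overview there); the theorems are in part 3,
`WellPoisedFaceTailOddWindow`.  With the partial-fraction data `c_{o,p}` of `R` (`exists_tailData`) and the
reflection `R(−t − h₀) = (−1)^{B(η₀n+1)+1} R(t)` (`tailRQ_reflect`) we prove, for `B ≥ 3` tail bricks on an integral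
face direction (`2η_j < η₀`; `N = η₀ n`):

* §T4 `t·R(t) → 0` along the naturals (file B's `tailR_decay`), hence the constant of the data is `0`
  (`tail_const_eq_zero`), the residues sum to zero (`tail_sum_order_zero` ⇒ no `ζ(3)`), and the data have the
  parity `c_{o,N−p} = (−1)^{B(N+1)+o} c_{o,p}` (`tail_data_reflect`), so that `Σ_p c_{o,p} = 0` whenever
  `B(N+1) + o` is odd (`tail_sum_vanish` — even `B`: every odd order, i.e. no even zeta value);
* §T5 `Σ_{t≥0} R″(t)` converges through the partial fractions (`hasSum_iteratedDeriv_two_tailR`) and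
  `F = ½ Σ_t R″(t) = Σ_{o<B} A_o ζ(o+3) − A₀` with `A_o = tailCoef = binom(o+2,2) Σ_p c_{o,p}` and
  `A₀ = tailConst = Σ_{p,o} binom(o+2,2) c_{o,p} H_p^{(o+3)}` (`tailF_eq_coef`).

This is fam-vwp gen 7's `WellPoisedFaceLinearForms` §§4–5 (`η : Fin 4 → ℕ`, sign `−1`) with `B` bricks and the sign
`(−1)^{B(η₀n+1)+1}`; the Literature machinery (`pf_unique`, `pfEval_reflect`, `tendsto_mul_pfEval`,
`hasSum_one_div_pow_shift`) is generic in the order count.  Forms of this kind prove nothing about `ζ(5)`, `ζ(7)`,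
`ζ(9)` [Zudilin2004, §8; Lemma 19].  Standard axioms only.
-/

noncomputable section

open Finset Filter Topology

namespace Summit.KontsevichZagierPeriods.Zeta5Search.WellPoisedFaceRate

open Literature.NumberTheory.Transcendental (zetaValue)
open Literature.NumberTheory.Transcendental.BallRivoal (pfEval harm pfEval_add pfEval_const_mul pfEval_reflect
  pf_unique tendsto_mul_pfEval hasSum_one_div_pow_shift)

variable {B : ℕ} (η₀ : ℕ) (η : Fin B → ℕ) (n : ℕ)

/-! ## T4. Decay `t·R(t) → 0`, the constant, the residues, the parity of the data -/

/-- `k·R(k) → 0` along the naturals, `B ≥ 3` (file B's `tailR_decay`: `R(t) ≤ 2h₀² R(0)/(t+h₀)²` on `t ≥ 0`). -/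
theorem tendsto_mul_tailR (hB : 3 ≤ B) (hη : ∀ j, 2 * η j < η₀) :
    Tendsto (fun k : ℕ => (k : ℝ) * tailR η₀ η n k) atTop (𝓝 0) := by
  set h0 : ℝ := ((η₀ * n + 2 : ℕ) : ℝ) with hh0
  set M : ℝ := 2 * h0 ^ 2 * tailR η₀ η n 0 with hM
  have hR0 : 0 < tailR η₀ η n 0 := tailR_pos η₀ η n (by norm_num)
  have h0pos : 0 < h0 := by rw [hh0]; positivity
  have hMnn : 0 ≤ M := by rw [hM]; positivity
  refine tendsto_of_tendsto_of_tendsto_of_le_of_le' tendsto_const_nhds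
    (tendsto_const_div_atTop_nhds_zero_nat M) ?_ ?_
  · filter_upwards with k
    have hk : (-1/2 : ℝ) < (k : ℝ) := by have : (0 : ℝ) ≤ k := Nat.cast_nonneg k; linarith
    exact mul_nonneg (Nat.cast_nonneg k) (tailR_pos η₀ η n hk).le
  · filter_upwards [eventually_ge_atTop 1] with k hk
    have hk' : (1 : ℝ) ≤ (k : ℝ) := by exact_mod_cast hk
    have hdec := tailR_decay hB η₀ η hη n (Nat.cast_nonneg k : (0 : ℝ) ≤ (k : ℝ))
    have hkh : 0 < (k : ℝ) + h0 := by linarith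
    have hsq : (k : ℝ) * (k : ℝ) ≤ ((k : ℝ) + h0) ^ 2 := by nlinarith
    have hfrac : (k : ℝ) / ((k : ℝ) + h0) ^ 2 ≤ 1 / (k : ℝ) := by
      rw [div_le_div_iff₀ (by positivity) (by positivity)]
      nlinarith
    calc (k : ℝ) * tailR η₀ η n k
        ≤ (k : ℝ) * (2 * h0 ^ 2 / ((k : ℝ) + h0) ^ 2 * tailR η₀ η n 0) :=
          mul_le_mul_of_nonneg_left hdec (Nat.cast_nonneg k)
      _ = M * ((k : ℝ) / ((k : ℝ) + h0) ^ 2) := by rw [hM]; field_simp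
      _ ≤ M * (1 / (k : ℝ)) := mul_le_mul_of_nonneg_left hfrac hMnn
      _ = M / (k : ℝ) := by rw [mul_one_div]

/-- `R(k) → 0` along the naturals (`B ≥ 3`). -/
theorem tendsto_tailR (hB : 3 ≤ B) (hη : ∀ j, 2 * η j < η₀) :
    Tendsto (fun k : ℕ => tailR η₀ η n k) atTop (𝓝 0) := by
  have h := (tendsto_mul_tailR η₀ η n hB hη).div_atTop tendsto_natCast_atTop_atTop
  refine h.congr' ?_
  filter_upwards [eventually_ge_atTop 1] with k hk
  have hk' : (k : ℝ) ≠ 0 := by positivity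
  field_simp

/-- The `ζ(o+3)`-coefficient of data `c`: `A_o = binom(o+2, 2)·Σ_p c_{o,p}` (half the second derivative of
`c/(t+p+1)^{o+1}` sums over `t ≥ 0` to `binom(o+2,2)·c·(ζ(o+3) − H_p^{(o+3)})`). -/
def tailCoef (N : ℕ) (c : ℕ → ℕ → ℚ) (o : ℕ) : ℚ :=
  ((o : ℚ) + 1) * ((o : ℚ) + 2) / 2 * ∑ p ∈ range (N + 1), c o p

/-- The constant term `A₀ = Σ_p Σ_{o<K} binom(o+2,2) c_{o,p} H_p^{(o+3)}` of data `c` with `K` orders. -/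
def tailConst (N K : ℕ) (c : ℕ → ℕ → ℚ) : ℚ :=
  ∑ p ∈ range (N + 1), ∑ o ∈ range K, ((o : ℚ) + 1) * ((o : ℚ) + 2) / 2 * (c o p * harm (o + 3) p)

section Data

variable {η₀ η n}
variable (hB : 3 ≤ B) (hη : ∀ j, 2 * η j < η₀) {c : ℕ → ℕ → ℚ} {C : ℚ}
  (hc : ∀ t : ℚ, (∀ p, p ≤ η₀ * n → t + p + 1 ≠ 0) → tailRQ η₀ η n t = pfEval (η₀ * n) B c t + C)
include hB hη hc

omit hB hη in
/-- `tailR k` is the cast of `pfEval … k + C` at a natural `k`. -/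
theorem tailR_natCast (k : ℕ) : tailR η₀ η n k = (pfEval (η₀ * n) B c k : ℝ) + (C : ℝ) := by
  have e := hc k (natCast_good k)
  have : tailR η₀ η n (k : ℝ) = ((tailRQ η₀ η n k : ℚ) : ℝ) := by rw [cast_tailRQ]; push_cast; rfl
  rw [this, e]
  push_cast
  rfl

/-- **The constant vanishes** (`B ≥ 3`): `C = 0` (both `R(k)` and the partial fractions tend to `0`). -/
theorem tail_const_eq_zero : C = (0 : ℚ) := by
  have h1 : Tendsto (fun k : ℕ => tailR η₀ η n k - (pfEval (η₀ * n) B c k : ℝ)) atTop (𝓝 (0 - 0)) :=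
    (tendsto_tailR η₀ η n hB hη).sub (WedgeDictionary.pfEval_tendsto_zero (η₀ * n) B c)
  rw [sub_zero] at h1
  have h2 : Tendsto (fun _ : ℕ => (C : ℝ)) atTop (𝓝 0) := by
    refine h1.congr fun k => ?_
    rw [tailR_natCast hc k]
    ring
  have := tendsto_nhds_unique h2 tendsto_const_nhds
  exact_mod_cast this.symm

/-- **The residues sum to zero** (`⇒` no `ζ(3)`): `Σ_p c_{0,p} = 0`, because `k·R(k) → 0` while
`k·Σ c_{o,p}/(k+p+1)^{o+1} → Σ_p c_{0,p}`. [Zudilin2004, proof of Lemma 19: "R(t) = O(t⁻²)"] -/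
theorem tail_sum_order_zero : ∑ p ∈ range (η₀ * n + 1), c 0 p = (0 : ℚ) := by
  have hC := tail_const_eq_zero hB hη hc
  have h1 := tendsto_mul_pfEval (η₀ * n) B c
  have h2 : Tendsto (fun k : ℕ => (k : ℝ) * (pfEval (η₀ * n) B c k : ℝ)) atTop (𝓝 0) := by
    refine (tendsto_mul_tailR η₀ η n hB hη).congr fun k => ?_
    rw [tailR_natCast hc k, hC]
    push_cast
    ring
  have h3 := tendsto_nhds_unique h1 h2
  have h4 : ∀ p, ∑ o ∈ range B, (c o p : ℝ) * (0 : ℝ) ^ o = c 0 p := fun p => by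
    obtain ⟨B', hB'⟩ : ∃ B', B = B' + 1 := ⟨B - 1, by omega⟩
    rw [hB', sum_range_succ']
    simp
  simp only [h4] at h3
  exact_mod_cast h3

/-- **Parity of the data** from the reflection: `c_{o,N−p} = (−1)^{B(N+1)+o} c_{o,p}` (`N = η₀ n`). -/
theorem tail_data_reflect (o p : ℕ) (ho : o < B) (hp : p ≤ η₀ * n) :
    c o (η₀ * n - p) = (-1) ^ (B * (η₀ * n + 1) + o) * c o p := by
  have hC := tail_const_eq_zero hB hη hc
  set f : ℕ → ℕ → ℚ := fun o p => (-1) ^ (o + 1) * c o (η₀ * n - p) with hf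
  have he : ∀ k : ℕ, 0 ≤ k →
      pfEval (η₀ * n) B (f + fun o p => -((-1 : ℚ) ^ (B * (η₀ * n + 1) + 1)) * c o p) k = 0 := by
    intro k _
    have hgood1 := natCast_good (η₀ := η₀) (n := n) k
    have hgood2 : ∀ p, p ≤ η₀ * n → (-(k : ℚ) - ((η₀ * n : ℕ) : ℚ) - 2) + p + 1 ≠ 0 := by
      intro p hp h0
      have hp' : (p : ℚ) ≤ ((η₀ * n : ℕ) : ℚ) := by exact_mod_cast hp
      have hk : (0 : ℚ) ≤ k := by positivity
      linarith
    have e1 := hc _ hgood2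
    have e2 := hc _ hgood1
    rw [hC, add_zero] at e1 e2
    have e3 := tailRQ_reflect η₀ η n hη (k : ℚ)
    rw [pfEval_add, hf, pfEval_reflect, pfEval_const_mul]
    linear_combination -e1 + (-1 : ℚ) ^ (B * (η₀ * n + 1) + 1) * e2 + e3
  have hz := pf_unique (η₀ * n) B _ 0 (fun k _ => he k (Nat.zero_le k)) o p ho hp
  simp only [Pi.add_apply, hf] at hz
  have hsq : ((-1 : ℚ) ^ (o + 1)) * (-1) ^ (o + 1) = 1 := by
    rw [← pow_add, ← two_mul]
    exact Even.neg_one_pow ⟨o + 1, by ring⟩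
  calc c o (η₀ * n - p) = ((-1 : ℚ) ^ (o + 1) * (-1) ^ (o + 1)) * c o (η₀ * n - p) := by rw [hsq, one_mul]
    _ = (-1) ^ (o + 1) * ((-1) ^ (B * (η₀ * n + 1) + 1) * c o p) := by
        rw [mul_assoc]
        congr 1
        linear_combination hz
    _ = (-1) ^ (B * (η₀ * n + 1) + o) * c o p := by
        rw [← mul_assoc, ← pow_add, show o + 1 + (B * (η₀ * n + 1) + 1) = (B * (η₀ * n + 1) + o) + 2 by ring,
          pow_add, neg_one_sq, mul_one]

/-- **Orders of the wrong parity cancel**: `Σ_p c_{o,p} = 0` whenever `B(η₀n+1) + o` is odd — for even `B`,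
every odd order `o` (`⇒` no even zeta value `ζ(o+3)`). -/
theorem tail_sum_vanish (o : ℕ) (ho : o < B) (hodd : Odd (B * (η₀ * n + 1) + o)) :
    ∑ p ∈ range (η₀ * n + 1), c o p = 0 := by
  have hrefl : ∑ p ∈ range (η₀ * n + 1), c o p = ∑ p ∈ range (η₀ * n + 1), c o (η₀ * n - p) := by
    rw [← sum_range_reflect (fun p => c o p) (η₀ * n + 1)]
    refine sum_congr rfl fun p _ => ?_
    show c o (η₀ * n + 1 - 1 - p) = c o (η₀ * n - p)
    rw [Nat.add_sub_cancel]
  have hneg : ∀ p ∈ range (η₀ * n + 1), c o (η₀ * n - p) = -c o p := fun p hp => by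
    rw [tail_data_reflect hB hη hc o p ho (by have := mem_range.1 hp; omega), hodd.neg_one_pow]
    ring
  rw [sum_congr rfl hneg, sum_neg_distrib] at hrefl
  linarith

/-! ## T5. Summation: `F = ½ Σ_t R″(t)` as a linear form -/

/-- `R″(t)` at a natural `t`, through the partial fractions. -/
theorem iteratedDeriv_two_tailR_eq (t : ℕ) :
    iteratedDeriv 2 (tailR η₀ η n) (t : ℝ) = ∑ p ∈ range (η₀ * n + 1), ∑ o ∈ range B,
      (c o p : ℝ) * ((((o + 1 : ℕ) : ℝ) * ((o + 1 : ℕ) + 1)) *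
        (((t : ℝ) + ((p + 1 : ℕ) : ℝ)) ^ (o + 1 + 2))⁻¹) := by
  have hC := tail_const_eq_zero hB hη hc
  have ht0 : (0 : ℝ) ≤ t := Nat.cast_nonneg t
  have heq : tailR η₀ η n =ᶠ[𝓝 (t : ℝ)] tailPfR (η₀ * n) B c := by
    filter_upwards [Ioi_mem_nhds (show (-1/2 : ℝ) < t by linarith)] with y hy
    have hy' : (-1/2 : ℝ) < y := hy
    rw [tailR_eq_pfR η₀ η n hc hy', hC, Rat.cast_zero, add_zero]
  rw [heq.iteratedDeriv_eq, iteratedDeriv_two_tailPfR (η₀ * n) B c (by linarith)]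

/-- **`Σ_{t ≥ 0} R″(t)` converges to `Σ_{p,o} c_{o,p}(o+1)(o+2)(ζ(o+3) − H_p^{(o+3)})`.** -/
theorem hasSum_iteratedDeriv_two_tailR :
    HasSum (fun t : ℕ => iteratedDeriv 2 (tailR η₀ η n) (t : ℝ))
      (∑ p ∈ range (η₀ * n + 1), ∑ o ∈ range B,
        (c o p : ℝ) * ((((o + 1 : ℕ) : ℝ) * ((o + 1 : ℕ) + 1)) *
          (zetaValue (o + 3) - (harm (o + 3) p : ℝ)))) := by
  have hfun : (fun t : ℕ => iteratedDeriv 2 (tailR η₀ η n) (t : ℝ)) = fun t : ℕ =>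
      ∑ p ∈ range (η₀ * n + 1), ∑ o ∈ range B,
        (c o p : ℝ) * ((((o + 1 : ℕ) : ℝ) * ((o + 1 : ℕ) + 1)) *
          (((t : ℝ) + ((p + 1 : ℕ) : ℝ)) ^ (o + 1 + 2))⁻¹) :=
    funext fun t => iteratedDeriv_two_tailR_eq hB hη hc t
  rw [hfun]
  refine hasSum_sum fun p _ => hasSum_sum fun o _ => ?_
  refine HasSum.mul_left _ (HasSum.mul_left _ ?_)
  have h := hasSum_one_div_pow_shift (o + 3) p (by omega)
  have hfun2 : (fun t : ℕ => (((t : ℝ) + ((p + 1 : ℕ) : ℝ)) ^ (o + 1 + 2))⁻¹)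
      = fun k : ℕ => 1 / ((k : ℝ) + p + 1) ^ (o + 3) := by
    funext k
    rw [one_div]
    push_cast
    ring
  rw [hfun2]
  exact h

/-- **`F = Σ_{o<B} A_o ζ(o+3) − A₀`** for the data of `R` (before any cancellation). -/
theorem tailF_eq_coef :
    tailF η₀ η n = (∑ o ∈ range B, (tailCoef (η₀ * n) c o : ℝ) * zetaValue (o + 3))
      - (tailConst (η₀ * n) B c : ℝ) := by
  unfold tailF
  rw [(hasSum_iteratedDeriv_two_tailR hB hη hc).tsum_eq, mul_sum]
  have hE : ∀ p ∈ range (η₀ * n + 1),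
      (1 / 2 : ℝ) * ∑ o ∈ range B, (c o p : ℝ) * ((((o + 1 : ℕ) : ℝ) * ((o + 1 : ℕ) + 1)) *
          (zetaValue (o + 3) - (harm (o + 3) p : ℝ)))
        = (∑ o ∈ range B, ((o : ℝ) + 1) * ((o : ℝ) + 2) / 2 * (c o p : ℝ) * zetaValue (o + 3))
          - ∑ o ∈ range B, ((o : ℝ) + 1) * ((o : ℝ) + 2) / 2 * ((c o p : ℝ) * (harm (o + 3) p : ℝ)) := by
    intro p _
    rw [mul_sum, ← sum_sub_distrib]
    refine sum_congr rfl fun o _ => ?_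
    push_cast
    ring
  rw [sum_congr rfl hE, sum_sub_distrib, sum_comm]
  unfold tailCoef tailConst
  push_cast
  congr 1
  refine sum_congr rfl fun o _ => ?_
  rw [mul_sum, sum_mul]

end Data

end Summit.KontsevichZagierPeriods.Zeta5Search.WellPoisedFaceRate
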